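import Mathlib
import Literature.NumberTheory.LFunctions.Zhang2022.Section15ResidueMainTerms
import Literature.NumberTheory.LFunctions.Zhang2022.Section15ResidueLimits
import Literature.NumberTheory.LFunctions.Zhang2022.Section15ResidueNonvanishing
import Literature.NumberTheory.LFunctions.Zhang2022.TypedSection16B
import HarnessLib

/-!
# Zhang (2022) §16 p. 95: "by Lemma 5.8 and direct calculation, `ℛ₂* = β₁ + O(1/𝓛¹⁰)`,
# `ℛ₂ⱼ = −1/(β₁L′(1,χ)) + O(𝓛⁶)`" (Z22:§16.u043) — discharged modulo Lemma 5.4 (ii)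

Topic `Literature/NumberTheory/LFunctions/Zhang2022` (Landau–Siegel audit tree; verdict-neutral).
Y. Zhang, *Discrete mean estimates and the Landau–Siegel zero*, arXiv:2211.02515v1 (2022)
[Zhang2022LandauSiegel] — **an unrefereed manuscript under adjudication** (cell siegel-zhang, D-0069
width campaign). DISCHARGE file (theorems only; no new definitions, no new facts); no statement about
Theorems 1–2 of the manuscript or about Landau–Siegel zeros is made or implied.

DAG node `Z22:§16.u043` [Z22 p.95, tex L4674–L4677] (`Typed.Section16B.Step16_u043`, over the concrete
objects `Typed.Section16A.calR2star` = `L(1+β₁,χ)δ(1)/L′(1,χ)` and `Typed.Section16A.calR2 c′ χ j` = the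
`limUnder` residue of (16.11) at `s = −βⱼ`). Proved here from:
* Lemma 5.4 (ii) (`δ(1) = 1 + O(α log 𝓛)`) — the CLAIM node `Skeleton.Lemma54`, as a HYPOTHESIS;
* Lemma 5.8 — the tree theorem `Lemma58.lemma_5_8_of_le` (via `L_one_sub_beta_bounds`,
  `Section15ResidueNonvanishing`), Lemma 5.7 (`|L′(1,χ)| ≥ c`, tree);
* the closed forms `calR2_one_eq`, `calR2_two_eq` (`Section15ResidueLimits`; residue `1` of `ζ` via Mathlib
  `riemannZeta_residue_one`) and `uζ(1+u) = 1 + O(|u|)` (`zeta_shift_bounds`, Mathlib `riemannZeta₁`);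
* the parameter sizes of `Section15ResidueParams`/`Nonvanishing` (`α = π𝓛⁻⁹`, `|α log P₄ − π| ≤ 521π𝓛⁻⁷`,
  `|c′α𝓛| = |c′|π𝓛⁻⁸`).
The computation: `ℛ₂₁ = N·Q·Λ⁻¹·Z⁻¹·ω₁(β₂−β₁)` with `N = −1/(β₁L′)`, `Q = (−β₁)P₄^{β₂−β₁}/(β₂−β₁) =
(1−5e)/(1+7e)·e^{i((1+7e)θ−π)}`, `Λ = L(1−β₁,χ)/(−β₁L′)`, `Z = (−β₁)ζ(1−β₁)`, each of `Q, Λ, Z, ω` being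
`1 + O(𝓛⁻⁶)`; `|N| ≤ 2𝓛⁹/(πc)`; hence `ℛ₂₁ = N + O(𝓛³)` (printed: `O(𝓛⁶)`). Similarly
`ℛ₂₂ = N·q·Z_u·Z₂⁻¹·Λ₂⁻¹`, `u = β₁−β₂`, `q = (−β₁)/(β₁−β₂) = (1−5e)/(1+7e)`.
Combined with `step16_u044_of` (`Section15ResidueProducts`) this closes `Z22:§16.u044` modulo Lemma 5.4.
-/

noncomputable section

open Complex Real Filter Topology

namespace Literature.NumberTheory.LFunctions.Zhang2022.ResidueValues

open Skeleton Typed.Section16A Typed.Section16B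

variable (c' : ℝ)

/-! ## `ℛ₂* = β₁ + O(𝓛⁻¹⁰)` -/

/-- **`ℛ₂* = β₁ + O(1/𝓛¹⁰)`** (§16 p. 95, first half of `Z22:§16.u043`), from Lemma 5.4 (ii)
(hypothesis `Skeleton.Lemma54`) and Lemma 5.8 (tree): `ℛ₂* − β₁ = β₁(δ(1)−1) + r₁δ(1)/L′(1,χ)` with
`|r₁| ≤ C₈𝓛⁻¹⁵`, `|δ(1) − 1| ≤ C₄α log 𝓛`. [cite: Zhang2022LandauSiegel, §16 p. 95] -/
theorem calR2star_estimate (h54 : Lemma54) :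
    ∃ C : ℝ, 0 ≤ C ∧ ForAllLarge fun D _ χ => AssumptionA D χ →
      ‖calR2star c' χ - beta1 c' D‖ ≤ C * (ell D ^ 10)⁻¹ := by
  obtain ⟨k, C₄, h54'⟩ := h54
  obtain ⟨c, hc, h57⟩ := norm_deriv_LFunction_one_ge
  obtain ⟨D₀, hall⟩ := h54'.and h57
  set C₈ : ℝ := 1 + 16 * Real.exp (9 / 2) * π ^ 2 * 10 ^ 2 with hC₈
  have hC₈0 : 0 ≤ C₈ := by positivity
  refine ⟨2 * π ^ 2 * max C₄ 0 + C₈ * (1 + max C₄ 0 * π) / c, by positivity,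
    max D₀ (max ⌈Real.exp 3⌉₊ ⌈Real.exp (14 * |c'| * π)⌉₊), fun D _ χ hD hq hp hA => ?_⟩
  have hD₀ : D₀ ≤ D := le_trans (le_max_left _ _) hD
  obtain ⟨hL, he⟩ := thresholds c' (le_trans (le_max_right _ _) hD)
  have hℓ : 0 < ell D := by linarith
  have hℓ1 : 1 ≤ ell D := by linarith
  have hL' : 3 ≤ Real.log D := hL
  have hα := alpha_pos hL
  have hαeq := Section2.alpha_eq_pi_div_ell9 D
  obtain ⟨g54, g57⟩ := hall D χ hD₀ hq hp
  have hcL := g57 hA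
  set L1 : ℂ := deriv χ.LFunction 1 with hL1
  have hN : 0 < ‖L1‖ := lt_of_lt_of_le hc hcL
  have hL0 : L1 ≠ 0 := fun h => by rw [h, norm_zero] at hN; exact lt_irrefl _ hN
  have hδ : ‖deltaW D 1 - 1‖ ≤ max C₄ 0 * alpha D * Real.log (ell D) := by
    have h := (g54 1).2 (by rw [sub_self, norm_zero]; positivity)
    refine h.trans ?_
    have hlog : 0 ≤ Real.log (ell D) := Real.log_nonneg hℓ1
    gcongr
    exact le_max_left _ _
  have hA' : ‖χ.LFunction 1‖ ≤ 1 / Real.log D ^ 2022 := le_of_lt hA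
  have hKL : 10 * π ≤ Real.log D ^ 8 := by
    have h3 : (3 : ℝ) ^ 8 ≤ Real.log D ^ 8 := pow_le_pow_left₀ (by norm_num) hL' 8
    nlinarith [Real.pi_lt_four]
  have hβ1 := norm_beta1_le c' hL he
  have hs1 : ‖(1 + beta1 c' D) - 1‖ ≤ 10 * π / Real.log D ^ 9 := by
    rw [add_sub_cancel_left]
    refine hβ1.trans ?_
    rw [hαeq, ell]; rw [mul_div_assoc']; gcongr; norm_num
  have hr1 := Lemma58.lemma_5_8_of_le χ hp hL' hA' hKL hs1
  rw [add_sub_cancel_left] at hr1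
  set r₁ : ℂ := χ.LFunction (1 + beta1 c' D) - L1 * beta1 c' D with hr₁
  set r₃ : ℂ := deltaW D 1 - 1 with hr₃
  have hr1' : ‖r₁‖ ≤ C₈ / ell D ^ 15 := by rw [hr₁, hC₈]; exact hr1
  have hid : calR2star c' χ - beta1 c' D = beta1 c' D * r₃ + r₁ * (1 + r₃) / L1 := by
    have e1 : χ.LFunction (1 + beta1 c' D) = beta1 c' D * L1 + r₁ := by rw [hr₁]; ring
    have e3 : deltaW D 1 = 1 + r₃ := by rw [hr₃]; ring
    unfold calR2star
    rw [← hL1, e1, e3]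
    field_simp
    ring
  rw [hid]
  have hlogℓ : Real.log (ell D) ≤ ell D := (Real.log_le_sub_one_of_pos hℓ).trans (by linarith)
  have hlog0 : 0 ≤ Real.log (ell D) := Real.log_nonneg hℓ1
  have hαℓ9 : alpha D * ell D ^ 9 = π := by rw [hαeq]; field_simp
  have hαlog : alpha D * Real.log (ell D) ≤ π := by
    calc alpha D * Real.log (ell D) ≤ alpha D * ell D ^ 9 := by
          refine mul_le_mul_of_nonneg_left (hlogℓ.trans ?_) hα.le
          calc ell D = ell D ^ 1 := (pow_one _).symm
            _ ≤ ell D ^ 9 := pow_le_pow_right₀ hℓ1 (by norm_num)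
      _ = π := hαℓ9
  have h1r3 : ‖1 + r₃‖ ≤ 1 + max C₄ 0 * π := by
    refine (norm_add_le _ _).trans ?_
    rw [norm_one]
    have : ‖r₃‖ ≤ max C₄ 0 * π := hδ.trans (by
      rw [mul_assoc]; exact mul_le_mul_of_nonneg_left hαlog (le_max_right _ _))
    linarith
  have T1 : ‖beta1 c' D * r₃‖ ≤ 2 * π ^ 2 * max C₄ 0 / ell D ^ 10 := by
    rw [norm_mul]
    calc ‖beta1 c' D‖ * ‖r₃‖ ≤ (2 * alpha D) * (max C₄ 0 * alpha D * Real.log (ell D)) := by gcongr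
      _ ≤ (2 * alpha D) * (max C₄ 0 * alpha D * ell D) := by gcongr
      _ = 2 * max C₄ 0 * (alpha D * ell D ^ 9) ^ 2 / ell D ^ 17 := by field_simp
      _ = 2 * π ^ 2 * max C₄ 0 / ell D ^ 17 := by rw [hαℓ9]; ring
      _ ≤ 2 * π ^ 2 * max C₄ 0 / ell D ^ 10 := by
          refine div_le_div_of_nonneg_left (by positivity) (by positivity) ?_
          exact pow_le_pow_right₀ hℓ1 (by norm_num)
  have T2 : ‖r₁ * (1 + r₃) / L1‖ ≤ C₈ * (1 + max C₄ 0 * π) / c / ell D ^ 10 := by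
    rw [norm_div, norm_mul]
    calc ‖r₁‖ * ‖1 + r₃‖ / ‖L1‖ ≤ (C₈ / ell D ^ 15) * (1 + max C₄ 0 * π) / c := by
          exact div_le_div₀ (by positivity) (mul_le_mul hr1' h1r3 (norm_nonneg _) (by positivity)) hc hcL
      _ = C₈ * (1 + max C₄ 0 * π) / c / ell D ^ 15 := by field_simp
      _ ≤ C₈ * (1 + max C₄ 0 * π) / c / ell D ^ 10 := by
          refine div_le_div_of_nonneg_left (by positivity) (by positivity) ?_
          exact pow_le_pow_right₀ hℓ1 (by norm_num)
  calc ‖beta1 c' D * r₃ + r₁ * (1 + r₃) / L1‖ ≤ ‖beta1 c' D * r₃‖ + ‖r₁ * (1 + r₃) / L1‖ := norm_add_le _ _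
    _ ≤ 2 * π ^ 2 * max C₄ 0 / ell D ^ 10 + C₈ * (1 + max C₄ 0 * π) / c / ell D ^ 10 := by linarith
    _ = (2 * π ^ 2 * max C₄ 0 + C₈ * (1 + max C₄ 0 * π) / c) * (ell D ^ 10)⁻¹ := by ring

/-! ## `ℛ₂₁ = −1/(β₁L′(1,χ)) + O(𝓛³)` -/

/-- `|(1−5e)/(1+7e) − 1| ≤ 24|e|` for `|e| ≤ 1/14`. [cite: Zhang2022LandauSiegel, §15 p. 88] -/
theorem abs_ratio15_sub_one_le {e : ℝ} (he : |e| ≤ 1 / 14) :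
    |(1 - 5 * e) / (1 + 7 * e) - 1| ≤ 24 * |e| := by
  have he' := abs_le.mp he
  have h7 : (1 + 7 * e : ℝ) ≠ 0 := by
    intro h; linarith [he'.1]
  have hrew : (1 - 5 * e) / (1 + 7 * e) - 1 = -12 * e / (1 + 7 * e) := by
    rw [eq_div_iff h7, sub_mul, div_mul_cancel₀ _ h7]; ring
  rw [hrew, abs_div, abs_mul, abs_of_neg (by norm_num : (-12 : ℝ) < 0)]
  have hlow : 1 / 2 ≤ |1 + 7 * e| := by rw [le_abs]; left; linarith [he'.1]
  rw [div_le_iff₀ (by linarith)]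
  nlinarith [abs_nonneg e]

/-- `|(1+ae)θ − π| ≤ |θ − π| + |a||e||θ|`. [cite: Zhang2022LandauSiegel, §15 p. 88] -/
theorem abs_lin_mul_sub_pi_le (a e θ : ℝ) :
    |(1 + a * e) * θ - π| ≤ |θ - π| + |a| * |e| * |θ| := by
  have hrew : (1 + a * e) * θ - π = (θ - π) + a * (e * θ) := by ring
  rw [hrew]
  refine (abs_add_le _ _).trans ?_
  rw [abs_mul, abs_mul]
  linarith [mul_assoc |a| |e| |θ|]

/-- `|ω₁(w) − 1| ≤ 32𝓛⁻³⁰` for `|w| ≤ 8α` (`ω₁(w) = exp{w²/(4𝓛³⁰)}`, `α ≤ 1`).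
[cite: Zhang2022LandauSiegel, §4 (4.1)] -/
theorem norm_omega1_sub_one_le {D : ℕ} (hL : 3 ≤ ell D) {w : ℂ} (hw : ‖w‖ ≤ 8 * alpha D) :
    ‖GaussWeight.omega1 (ell D ^ 30) w - 1‖ ≤ 32 / ell D ^ 30 := by
  have hℓ : 0 < ell D := by linarith
  have hℓ1 : 1 ≤ ell D := by linarith
  have hα1 := alpha_le_one hL
  have hα0 := (alpha_pos hL).le
  unfold GaussWeight.omega1
  have hz : ‖w ^ 2 / ((4 * ell D ^ 30 : ℝ) : ℂ)‖ ≤ 16 / ell D ^ 30 := by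
    rw [norm_div, norm_pow, Complex.norm_real, Real.norm_eq_abs, abs_of_pos (by positivity)]
    rw [div_le_div_iff₀ (by positivity) (by positivity)]
    have hw2 : ‖w‖ ^ 2 ≤ (8 * alpha D) ^ 2 := pow_le_pow_left₀ (norm_nonneg _) hw 2
    have hw64 : ‖w‖ ^ 2 ≤ 64 := by nlinarith
    have h30 := mul_le_mul_of_nonneg_right hw64 (pow_pos hℓ 30).le
    linarith
  have hz1 : ‖w ^ 2 / ((4 * ell D ^ 30 : ℝ) : ℂ)‖ ≤ 1 := hz.trans (by
    rw [div_le_one (by positivity)]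
    have : (3 : ℝ) ^ 30 ≤ ell D ^ 30 := pow_le_pow_left₀ (by norm_num) hL 30
    nlinarith)
  calc ‖Complex.exp (w ^ 2 / ((4 * ell D ^ 30 : ℝ) : ℂ)) - 1‖ ≤ 2 * ‖w ^ 2 / ((4 * ell D ^ 30 : ℝ) : ℂ)‖ :=
        Complex.norm_exp_sub_one_le hz1
    _ ≤ 2 * (16 / ell D ^ 30) := by gcongr
    _ = 32 / ell D ^ 30 := by ring

/-- The algebra behind `ℛ₂₁ = N·Q·Λ⁻¹·Z⁻¹·ω`: for non-zero `b, L, z, l, d`,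
`(zl)⁻¹·(Pw/d) + 1/(bL) = (−1/(bL))·((−bP/d)·(l/(−bL))⁻¹·(−bz)⁻¹·w − 1)`.
[cite: Zhang2022LandauSiegel, §16 p. 95] -/
theorem residue_identity_one {b L z l d P w : ℂ} (hb : b ≠ 0) (hL : L ≠ 0) (hz : z ≠ 0) (hl : l ≠ 0)
    (hd : d ≠ 0) :
    (z * l)⁻¹ * (P * w / d) + 1 / (b * L) =
      -1 / (b * L) * (-b * P / d * (l / (-b * L))⁻¹ * (-b * z)⁻¹ * w - 1) := by
  field_simp
  ring

set_option maxHeartbeats 400000 in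
/-- **`ℛ₂₁ = −1/(β₁L′(1,χ)) + O(𝓛⁶)`** (§16 p. 95, second half of `Z22:§16.u043`, `j = 1`), from the
closed form `calR2_one_eq`, `uζ(1+u) = 1 + O(|u|)`, Lemma 5.8 (`L(1−β₁,χ) = −β₁L′(1+O(𝓛⁻⁶))`),
`P₄^{β₂−β₁} = −1 + O(𝓛⁻⁷)`, `(−β₁)/(β₂−β₁) = −1 + O(𝓛⁻⁸)`; in fact with error `O(𝓛³)`.
[cite: Zhang2022LandauSiegel, §16 p. 95] -/
theorem calR2_one_estimate :
    ∃ C : ℝ, 0 ≤ C ∧ ForAllLarge fun D _ χ => AssumptionA D χ →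
      ‖calR2 c' χ 1 + 1 / (beta1 c' D * deriv χ.LFunction 1)‖ ≤ C * ell D ^ 6 := by
  obtain ⟨c, hc, h57⟩ := norm_deriv_LFunction_one_ge
  obtain ⟨r, hr, K, hK, hζ⟩ := zeta_shift_bounds
  obtain ⟨CL, hCL0, hLb⟩ := L_one_sub_beta_bounds
  obtain ⟨D₀, hall⟩ := h57.and hLb
  -- the total constant
  set Ktot : ℝ := 8 * (24 * |c'| * π + 521 * π + 4900 * (|c'| * π)) + 4 * (2 * CL) + 2 * (16 * K * π) + 32
    with hKtot
  have hKtot0 : 0 ≤ Ktot := by positivity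
  refine ⟨2 / (π * c) * Ktot, by positivity,
    max D₀ (max (max ⌈Real.exp 3⌉₊ ⌈Real.exp (14 * |c'| * π)⌉₊)
      (max ⌈Real.exp (8 * π / r + 1)⌉₊ ⌈Real.exp (16 * K * π + 1)⌉₊)), fun D _ χ hD hq hp hA => ?_⟩
  have hD₀ : D₀ ≤ D := le_trans (le_max_left _ _) hD
  have hD1 := le_trans (le_trans (le_max_left _ _) (le_max_right _ _)) hD
  have hD2 := le_trans (le_trans (le_max_left _ _) (le_trans (le_max_right _ _) (le_max_right _ _))) hD
  have hD3 := le_trans (le_trans (le_max_right _ _) (le_trans (le_max_right _ _) (le_max_right _ _))) hD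
  obtain ⟨hL, he⟩ := thresholds c' hD1
  have hℓ : 0 < ell D := by linarith
  have hℓ1 : 1 ≤ ell D := by linarith
  have hα := alpha_pos hL
  have hαeq := Section2.alpha_eq_pi_div_ell9 D
  have hαℓ9 : alpha D * ell D ^ 9 = π := by rw [hαeq]; field_simp
  -- `8α < r` and `16Kπ ≤ 𝓛 ≤ 𝓛⁹`
  have hlogD2 : 8 * π / r + 1 ≤ ell D := by
    have h : Real.exp (8 * π / r + 1) ≤ D := le_trans (Nat.le_ceil _) (by exact_mod_cast hD2)
    exact (Real.le_log_iff_exp_le (lt_of_lt_of_le (Real.exp_pos _) h)).mpr h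
  have hlogD3 : 16 * K * π + 1 ≤ ell D := by
    have h : Real.exp (16 * K * π + 1) ≤ D := le_trans (Nat.le_ceil _) (by exact_mod_cast hD3)
    exact (Real.le_log_iff_exp_le (lt_of_lt_of_le (Real.exp_pos _) h)).mpr h
  have h8α : 8 * alpha D < r := by
    have h1 : alpha D ≤ π / ell D := alpha_le hL
    have h2 : 8 * π / r < ell D := by linarith
    calc 8 * alpha D ≤ 8 * (π / ell D) := by linarith
      _ = (8 * π / r) * (r / ell D) := by field_simp
      _ < ell D * (r / ell D) := by gcongr
      _ = r := by field_simp
  obtain ⟨g57, gL⟩ := hall D χ hD₀ hq hp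
  clear hall
  have hcL := g57 hA
  clear g57
  set L1 : ℂ := deriv χ.LFunction 1 with hL1
  have hN : 0 < ‖L1‖ := lt_of_lt_of_le hc hcL
  have hL0 : L1 ≠ 0 := fun h => by rw [h, norm_zero] at hN; exact lt_irrefl _ hN
  have hχ1 : χ ≠ 1 := by
    have hD1' : D ≠ 1 := by
      rintro rfl; norm_num [ell] at hL
    exact GammaFactor.ne_one_of_isPrimitive hp hD1'
  -- sizes of the shifts
  have he' := abs_le.mp he
  obtain ⟨hβ1l, -, -⟩ := norm_beta_ge c' hL he
  have hβ1u := norm_beta1_le c' hL he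
  obtain ⟨⟨h21l, h21u⟩, -, -⟩ := norm_beta_sub c' hL he
  have hβ1ne : beta1 c' D ≠ 0 := fun h => by rw [h, norm_zero] at hβ1l; linarith
  have h21ne : beta2 c' D - beta1 c' D ≠ 0 := fun h => by rw [h, norm_zero] at h21l; linarith
  have hP := P4_pos hL
  -- the `ζ` factor `Z = (−β₁)ζ(1−β₁)`
  have hu1 : ‖-beta1 c' D‖ < r := by rw [norm_neg]; linarith
  obtain ⟨hζne, hZ1, hZhalf⟩ := hζ (-beta1 c' D) (neg_ne_zero.mpr hβ1ne) hu1
  clear hζ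
  have hζne' : riemannZeta (1 - beta1 c' D) ≠ 0 := by rw [sub_eq_add_neg]; exact hζne
  set Z : ℂ := -beta1 c' D * riemannZeta (1 - beta1 c' D) with hZdef
  have hZ1' : ‖Z - 1‖ ≤ K * ‖-beta1 c' D‖ := by rw [hZdef, sub_eq_add_neg]; exact hZ1
  have hZhalf' : ‖Z - 1‖ ≤ 1 / 2 := by rw [hZdef, sub_eq_add_neg]; exact hZhalf
  have hZne : Z ≠ 0 := by
    intro h; rw [h, zero_sub, norm_neg, norm_one] at hZhalf'; norm_num at hZhalf'
  have hKα : K * (2 * alpha D) ≤ 1 / 2 := by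
    calc K * (2 * alpha D) ≤ K * (2 * (π / ell D)) := by gcongr; exact alpha_le hL
      _ = 2 * K * π / ell D := by ring
      _ ≤ 1 / 2 := by
          rw [div_le_iff₀ hℓ]
          nlinarith [mul_nonneg hK Real.pi_pos.le]
  have tZ : ‖Z⁻¹ - 1‖ ≤ 16 * K * π / ell D ^ 9 := by
    have h := norm_inv_sub_one_le hZ1' (by
      calc K * ‖-beta1 c' D‖ ≤ K * (2 * alpha D) := by rw [norm_neg]; gcongr
        _ ≤ 1 / 2 := hKα)
    calc ‖Z⁻¹ - 1‖ ≤ 2 * (K * ‖-beta1 c' D‖) := h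
      _ ≤ 2 * (K * (2 * alpha D)) := by rw [norm_neg]; gcongr
      _ = 4 * K * π / ell D ^ 9 := by rw [hαeq]; ring
      _ ≤ 16 * K * π / ell D ^ 9 := by gcongr; nlinarith [mul_nonneg hK Real.pi_pos.le]
  have tZ1 : 16 * K * π / ell D ^ 9 ≤ 1 := by
    rw [div_le_one (pow_pos hℓ 9)]
    calc 16 * K * π ≤ ell D := by linarith
      _ = ell D ^ 1 := (pow_one _).symm
      _ ≤ ell D ^ 9 := pow_le_pow_right₀ hℓ1 (by norm_num)
  -- the `L` factor `Λ = L(1−β₁)/(−β₁L′)`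
  obtain ⟨hLne, hΛ, hΛhalf⟩ := gL hA (beta1 c' D) hβ1l (hβ1u.trans (by linarith))
  clear gL
  set Λ : ℂ := χ.LFunction (1 - beta1 c' D) / (-beta1 c' D * L1) with hΛdef
  have hΛne : Λ ≠ 0 := by
    intro h; rw [h, zero_sub, norm_neg, norm_one] at hΛ; linarith
  have tΛ : ‖Λ⁻¹ - 1‖ ≤ 2 * (CL / ell D ^ 6) := norm_inv_sub_one_le hΛ hΛhalf
  have tΛ1 : 2 * (CL / ell D ^ 6) ≤ 1 := by linarith
  -- the `ω₁` factor
  set ω : ℂ := GaussWeight.omega1 (ell D ^ 30) (beta2 c' D - beta1 c' D) with hωdef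
  have tω : ‖ω - 1‖ ≤ 32 / ell D ^ 30 := norm_omega1_sub_one_le hL h21u
  have tω1 : 32 / ell D ^ 30 ≤ 1 := by
    rw [div_le_one (pow_pos hℓ 30)]
    have : (3 : ℝ) ^ 30 ≤ ell D ^ 30 := pow_le_pow_left₀ (by norm_num) hL 30
    nlinarith
  -- the main factor `Q = (−β₁)P₄^{β₂−β₁}/(β₂−β₁) = (1−5e)/(1+7e)·e^{iφ}`
  set e : ℝ := c' * alpha D * ell D with he_def
  set θ : ℝ := alpha D * Real.log (P4 D) with hθ_def
  have h7 : (1 + 7 * e : ℝ) ≠ 0 := by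
    intro h; have := he'.1; linarith
  have hPow : ((P4 D : ℝ) : ℂ) ^ (beta2 c' D - beta1 c' D) =
      -Complex.exp (I * (((1 + 7 * e) * θ - π : ℝ) : ℂ)) := by
    have h21 : beta2 c' D - beta1 c' D = I * ((alpha D * (1 + 7 * e)) : ℝ) := by
      rw [beta1_eq, beta2_eq, ← he_def]; push_cast; ring
    rw [h21, ofReal_cpow_I_mul hP]
    have harg : I * (((alpha D * (1 + 7 * e)) * Real.log (P4 D) : ℝ) : ℂ) =
        I * (((1 + 7 * e) * θ - π : ℝ) : ℂ) + π * I := by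
      rw [hθ_def]; push_cast; ring
    rw [harg, Complex.exp_add, Complex.exp_pi_mul_I, mul_neg_one]
  set Q : ℂ := -beta1 c' D * ((P4 D : ℝ) : ℂ) ^ (beta2 c' D - beta1 c' D) / (beta2 c' D - beta1 c' D)
    with hQdef
  have hQ : Q = (((1 - 5 * e) / (1 + 7 * e) : ℝ) : ℂ) * Complex.exp (I * (((1 + 7 * e) * θ - π : ℝ) : ℂ)) := by
    rw [hQdef, hPow]
    have h21 : beta2 c' D - beta1 c' D = I * ((alpha D * (1 + 7 * e)) : ℝ) := by
      rw [beta1_eq, beta2_eq, ← he_def]; push_cast; ring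
    rw [h21, beta1_eq, ← he_def]
    have h7c : ((1 + 7 * e : ℝ) : ℂ) ≠ 0 := Complex.ofReal_ne_zero.mpr h7
    have hαc : ((alpha D : ℝ) : ℂ) ≠ 0 := Complex.ofReal_ne_zero.mpr hα.ne'
    push_cast at h7c ⊢
    field_simp
  have tQ : ‖Q - 1‖ ≤ 24 * |e| + (|θ - π| + 7 * |e| * |θ|) := by
    rw [hQ]
    have hmain := norm_ofReal_mul_exp_sub_le ((1 - 5 * e) / (1 + 7 * e)) ((1 + 7 * e) * θ - π) 1
    push_cast at hmain ⊢
    refine hmain.trans ?_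
    have hq := abs_ratio15_sub_one_le he
    have hφ := abs_lin_mul_sub_pi_le 7 e θ
    rw [show |(7 : ℝ)| = 7 by norm_num] at hφ
    rw [abs_one, one_mul]
    exact add_le_add hq hφ
  -- the value of `ℛ₂₁` and the identity `ℛ₂₁ − N = N (QΛ⁻¹Z⁻¹ω − 1)`
  have hval := calR2_one_eq c' χ hχ1 hP h21ne hβ1ne hζne' hLne
  set N : ℂ := -1 / (beta1 c' D * L1) with hNdef
  have hid : calR2 c' χ 1 + 1 / (beta1 c' D * L1) = N * (Q * Λ⁻¹ * Z⁻¹ * ω - 1) := by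
    rw [hval]
    exact residue_identity_one hβ1ne hL0 hζne' hLne h21ne
  rw [hid, norm_mul]
  -- `|N| ≤ 2𝓛⁹/(πc)`
  have hNb : ‖N‖ ≤ 2 / (π * c) * ell D ^ 9 := by
    rw [hNdef, norm_div, norm_neg, norm_one, norm_mul]
    have hden : alpha D / 2 * c ≤ ‖beta1 c' D‖ * ‖L1‖ := mul_le_mul hβ1l hcL hc.le (norm_nonneg _)
    calc 1 / (‖beta1 c' D‖ * ‖L1‖) ≤ 1 / (alpha D / 2 * c) :=
          one_div_le_one_div_of_le (by positivity) hden
      _ = 2 / (π * c) * ell D ^ 9 := by rw [hαeq]; field_simp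
  -- `|QΛ⁻¹Z⁻¹ω − 1| ≤ 8 t_Q + 4 t_Λ + 2 t_Z + t_ω`
  have hprod : ‖Q * Λ⁻¹ * Z⁻¹ * ω - 1‖ ≤
      2 * (2 * (2 * (24 * |e| + (|θ - π| + 7 * |e| * |θ|)) + 2 * (CL / ell D ^ 6)) +
        16 * K * π / ell D ^ 9) + 32 / ell D ^ 30 := by
    have s1 := norm_mul_sub_one_le tQ tΛ tΛ1
    have s2 := norm_mul_sub_one_le s1 tZ tZ1
    exact norm_mul_sub_one_le s2 tω tω1
  -- bookkeeping: everything over `𝓛⁶`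
  have h1 : |e| = |c'| * π / ell D ^ 8 := abs_e_eq c' hL
  have h2 := abs_alpha_mul_log_P4_sub_pi_le7 hL
  have h3 := abs_alpha_mul_log_P4_le hL
  rw [← hθ_def] at h2 h3
  have hsmall : 2 * (2 * (2 * (24 * |e| + (|θ - π| + 7 * |e| * |θ|)) + 2 * (CL / ell D ^ 6)) +
        16 * K * π / ell D ^ 9) + 32 / ell D ^ 30 ≤ Ktot / ell D ^ 6 := by
    have p6 : (0 : ℝ) < ell D ^ 6 := pow_pos hℓ 6
    have i1 : |e| ≤ |c'| * π / ell D ^ 6 := by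
      rw [h1]; exact div_le_div_of_nonneg_left (by positivity) p6 (pow_le_pow_right₀ hℓ1 (by norm_num))
    have i2 : |θ - π| ≤ 521 * π / ell D ^ 6 :=
      h2.trans (div_le_div_of_nonneg_left (by positivity) p6 (pow_le_pow_right₀ hℓ1 (by norm_num)))
    have i3 : |e| * |θ| ≤ |c'| * π / ell D ^ 6 * 700 := mul_le_mul i1 h3 (abs_nonneg _) (by positivity)
    have i4 : 16 * K * π / ell D ^ 9 ≤ 16 * K * π / ell D ^ 6 :=
      div_le_div_of_nonneg_left (by positivity) p6 (pow_le_pow_right₀ hℓ1 (by norm_num))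
    have i5 : 32 / ell D ^ 30 ≤ 32 / ell D ^ 6 :=
      div_le_div_of_nonneg_left (by positivity) p6 (pow_le_pow_right₀ hℓ1 (by norm_num))
    rw [hKtot]
    have eq : (8 * (24 * |c'| * π + 521 * π + 4900 * (|c'| * π)) + 4 * (2 * CL) + 2 * (16 * K * π) + 32) /
        ell D ^ 6 = 8 * (24 * (|c'| * π / ell D ^ 6) + (521 * π / ell D ^ 6 + 7 * (|c'| * π / ell D ^ 6 * 700)))
          + 4 * (2 * (CL / ell D ^ 6)) + 2 * (16 * K * π / ell D ^ 6) + 32 / ell D ^ 6 := by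
      field_simp; ring
    rw [eq]
    linarith only [i1, i2, i3, i4, i5, hCL0, hK, Real.pi_pos]
  calc ‖N‖ * ‖Q * Λ⁻¹ * Z⁻¹ * ω - 1‖ ≤ (2 / (π * c) * ell D ^ 9) * (Ktot / ell D ^ 6) := by
        refine mul_le_mul hNb (hprod.trans hsmall) (norm_nonneg _) (by positivity)
    _ = 2 / (π * c) * Ktot * ell D ^ 3 := by field_simp
    _ ≤ 2 / (π * c) * Ktot * ell D ^ 6 :=
        mul_le_mul_of_nonneg_left (pow_le_pow_right₀ hℓ1 (by norm_num : 3 ≤ 6))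
          (mul_nonneg (div_nonneg (by norm_num) (mul_pos Real.pi_pos hc).le) hKtot0)

end Literature.NumberTheory.LFunctions.Zhang2022.ResidueValues
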